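import Summits.NavierStokesRegularity.NavierStokesRegularity.Theses.FrozenSignCascade
import Summits.NavierStokesRegularity.NavierStokesRegularity.Theorems.FrozenSignCascadeBoundedEnvelopeContinuationOfLiouvillePM2
import Summits.NavierStokesRegularity.NavierStokesRegularity.Theorems.FrozenSignCascadeBoundedEnvelopeContinuationLiouvilleMorreyOfNoLocalTypeI
import Literature.Analysis.FluidPDE.LocalTypeI
import HarnessLib.Audit

/-!
# Skeleton of the crux `FrozenSignCascade.BoundedEnvelopeContinuation` — line `registered`
# (reshape r5 by the continuation lead c5, 2026-08-17: the open stub is Liouville on L^∞_t PM²_x)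

(crux item `stmt-NavierStokesRegularity-10579`, rank 4, conjunct (B) of route
`route-NavierStokesRegularity-FrozenSignCascade`; tree path
`Cruxes/BoundedEnvelopeContinuation/Lines/birth.lean`.)

THE CRUX (B). For `ν > 0` and a Clay datum `u₀`: IF at every horizon `T₀` the critical Fourier
envelope `‖ξ‖² ‖V t ξ‖` is bounded by one constant along ALL Fourier-side mild solutions `V`
(`IsFourierMild (4π²ν) 4 0 T V`, `V 0 = fourierData hu hd`, `T ≤ T₀`, `t ∈ [0,T]`), THEN `u₀`
launches a global smooth bounded-energy (Clay) solution.

HISTORY. r2 (lead c1): crux ⇐ `¬ LocalTypeISingularityExists` through the Seregin–Šverák zoom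
(stubs A `stub_morreyOfEnvelope` p149460, B `stub_stateOfKato` p147045, C p148717, E
`stub_clayOfBackwardBounded` p147057, bridge p151353). r3 (lead c2): the KNSS RECORD ZOOM inside the
smooth/mild category (Z1 `stub_recordSequence` p154438, Z2 `stub_zoomLimitMorrey` p154254, Z2c
`stub_nearFinalPersistence` p154477, (L)⇒(L_M) p154353, ¬LTISE⇒(L_M) p156854, composition
`stub_ofLiouvilleMorrey` p155260): one open stub (L_M) = Liouville for Morrey-bounded bounded
ancient mild solutions = Type-I exclusion in Liouville form (Barker–Prange 2020 §1.3). Lead c3: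
(L_M) PROVED for small Morrey constant (`liouvilleMorrey_small` p160131), crux PROVED for small
envelopes (p160437) and under the threshold hypothesis (p161477, containing item 10580).

STATE AFTER LEAD c4 (2026-08-17; everything below is a LANDED tree theorem `--supports` this crux,
namespace `…Theorems.BoundedEnvelope`):
* THE CRUX HOLDS UNCONDITIONALLY FOR AXISYMMETRIC CLAY DATA —
  `boundedEnvelopeContinuation_axisymmetric` (p168184; composition of `axisymmetric_of_datum` p165395,
  `shellSupBound_of_abScaledSum` p165902 (Seregin–Zajaczkowski 2007 Prop. 4.1 on shells),
  `axisDecay_of_typeIBound` p165542 (Seregin–Šverák axis decay from the Albritton–Barker Type-I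
  quantity), `zoomBundle_axis` p167655 (the zoom at an axis point) and the assembly
  `boundedEnvelopeContinuation_axisymmetric_of` p165385 through Seregin–Šverák 2009 Thm. 3.2
  `isRegularAtOrigin_of_axisDecay_holds` and the CKN off-axis theorem
  `axisymmetricL3_boundedNearTop_offAxis`): envelope-riding blow-up of an axisymmetric real flow is
  impossible (Seregin–Zhou 2020's axisymmetric corollary at the PM² level, Clay setting).
* (L_M) HOLDS IN THE AXISYMMETRIC CLASS — `liouvilleMorrey_axisymmetric` (p165977 + p168657, with `liouvillePM_axisymmetric`: global
  axis decay by un-zooming `axisDecay_core` at all scales, KNSS 2009 Thm. 5.3, continuity).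
* RESHAPE r4: the zoom limit inherits the full critical PSEUDO-MEASURE bound of the flow in dual
  form (`pm_dual_of_envelope`, `pm_dual_zoom`, `pm_dual_of_tendsto`, p166690), so the crux follows
  from the WEAKER Liouville statement (L_PM) below (`stub_ofLiouvillePM`, composition
  `boundedEnvelopeContinuation_of_liouvillePM`; (L_M) ⇒ (L_PM) is `liouvillePM_of_liouvilleMorrey`,
  so every bridge into (L_M) — (L) = item 10661, `¬ LocalTypeISingularityExists` = item 10480, the
  small-constant and axisymmetric regimes — is a bridge into (L_PM)).

RESHAPE r5 (lead c5, 2026-08-17). The Morrey hypothesis of r4's open stub (L_PM) is REDUNDANT: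
the dual pseudo-measure bound implies the all-radii Morrey bound with constant
`(54|B₁|³ + 18|B₁|) C'²` (`stub_morreyOfPMDual`, p172592: `PM² ⊂ Ṁ^{2,1}` by Plancherel on
`L¹ ∩ L²` and the MorreySharp shell integrals), so (L_PM) is EQUIVALENT to the statement below
(`liouvillePM2_of_liouvillePM` / `liouvillePM_of_liouvillePM2`, file `…OfLiouvillePM2.lean`), which
also PROVES it for a small pseudo-measure constant (`liouvillePM2_small`, the Liouville form of
the Le Jan–Sznitman / Cannone–Karch uniqueness).

THE ONE OPEN STUB is the Liouville statement

  (L_PM2) `stub_liouvillePM2`: a bounded ancient mild solution (`ν = 1`), jointly smooth and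
          Oseen-mild on `(-∞,0) × ℝ³`, whose slices obey the dual pseudo-measure bound
          `|∫ v_l(t) φ| ≤ C' ∫ ‖𝓕φ‖/‖ξ‖²` for all `t < 0` and all admissible real test
          functions `φ` — i.e. `v ∈ L^∞_t PM²_x` — vanishes identically.

It is the Liouville theorem for bounded ancient mild solutions in `L^∞_t PM²_x` = Type-I
exclusion in Liouville form restricted to that class (`PM² ⊂ Ṁ^{2,1}`, so the Albritton–Barker
Type-I quantity is finite); open (Barker–Prange 2020 §1.3; the `q = ∞` endpoint of the
ESS / GKP / Albritton criteria). Known in tree: small constant, axisymmetric. It is implied by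
(L_M), by (L) = item stmt-NavierStokesRegularity-10661 and by `¬ LocalTypeISingularityExists` =
item stmt-NavierStokesRegularity-10480 (`liouvillePM2_of_liouvilleMorrey`).
-/

noncomputable section

open Set MeasureTheory Filter Topology Metric Function
open scoped ENNReal
open Literature.Analysis Literature.Analysis.FluidPDE Literature.Analysis.FluidPDE.FourierNS

namespace Summit.NavierStokesRegularity.NavierStokesRegularity.Cruxes.BoundedEnvelopeContinuation.Birth

set_option linter.unusedVariables false
set_option linter.dupNamespace false

/-- **stub — `stub_liouvillePM2` (OPEN; the honest content (L_PM2) of the crux after r5).**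
A bounded ancient mild solution of Navier–Stokes (`ν = 1`) on `(-∞,0) × ℝ³` which is jointly
smooth and Oseen-mild on the open past and whose slices obey the dual pseudo-measure (`PM²`)
bound `|∫ (v t)_l φ| ≤ C' ∫ ‖𝓕φ(ξ)‖/‖ξ‖² dξ` at all negative times (for all real `φ` with `φ`
and `‖𝓕φ‖/‖ξ‖²` integrable), vanishes identically. Equivalent to r4's (L_PM) (the Morrey bound
it also assumed follows, `stub_morreyOfPMDual`); implied by (L_M), hence by (L) of KNSS 2009 and
by `¬ LocalTypeISingularityExists`; PROVED in tree for a small constant `C'` and for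
axisymmetric `v`. [cite: BarkerPrange2020, §1.3; AlbrittonBarker2019, Thm. 1.1;
LemarieRieusset2016, §8.5] [status: open] -/
theorem stub_liouvillePM2 :
    ∀ v : ℝ → EuclideanSpace ℝ (Fin 3) → EuclideanSpace ℝ (Fin 3),
      Literature.Analysis.FluidPDE.IsBoundedAncientMildSolution 1 v →
      ContDiffOn ℝ (⊤ : ℕ∞) (uncurry v) (Set.Iio 0 ×ˢ Set.univ) →
      (∀ s t : ℝ, s < t → t < 0 → ∀ x,
        v t x = UnboundedOperators.heatExtension (v s) (t - s) x -
          Literature.Analysis.FluidPDE.oseenDuhamel 1 s v v t x) →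
      (∃ C' : ℝ, ∀ t < 0, ∀ (l : Fin 3) (φ : EuclideanSpace ℝ (Fin 3) → ℝ),
        MeasureTheory.Integrable φ →
        MeasureTheory.Integrable (fun ξ : EuclideanSpace ℝ (Fin 3) =>
          ‖FourierTransform.fourier (fun x => (φ x : ℂ)) ξ‖ / ‖ξ‖ ^ 2) →
        |∫ y, v t y l * φ y| ≤
          C' * ∫ ξ : EuclideanSpace ℝ (Fin 3), ‖FourierTransform.fourier (fun x => (φ x : ℂ)) ξ‖ / ‖ξ‖ ^ 2) →
      ∀ t < 0, ∀ x, v t x = 0 := by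
  sorry

/-- **Composition (the skeleton theorem).** The crux BY NAME: the landed conditional theorem
`Theorems.BoundedEnvelope.stub_ofLiouvillePM2` (= `boundedEnvelopeContinuation_of_liouvillePM2`,
registered stub, lead c5: lead c2's record-zoom composition with lead c4's PM² inheritance, the
Morrey shadow being recovered from the PM² bound by `stub_morreyOfPMDual`) applied to the one
open registered stub `stub_liouvillePM2` (L_PM2). -/
theorem BoundedEnvelopeContinuation_of : Theses.FrozenSignCascade.BoundedEnvelopeContinuation :=
  Theorems.BoundedEnvelope.stub_ofLiouvillePM2 stub_liouvillePM2

/-- **The r2 bridge recovered through r5** (over the crux's definiens, so that `_of` stays the only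
theorem of this file concluding the crux by name):
`¬ LocalTypeISingularityExists ⇒ (L_M) ⇒ (L_PM2) ⇒ crux`. [cite: AlbrittonBarker2019, Thm. 1.1] -/
theorem crux_of_noLocalTypeI
    (hno : ¬ Literature.Analysis.FluidPDE.LocalTypeISingularityExists) :
    ∀ ν : ℝ, 0 < ν → ∀ (u₀ : EuclideanSpace ℝ (Fin 3) → EuclideanSpace ℝ (Fin 3))
      (hu : ContDiff ℝ (⊤ : ℕ∞) u₀) (hd : Literature.Analysis.FluidPDE.HasRapidSpatialDecay u₀),
      Literature.Analysis.FluidPDE.NSWave0.IsDivFree u₀ →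
      (∀ T₀ : ℝ, 0 < T₀ → ∃ C : ℝ, ∀ T : ℝ, T ≤ T₀ →
        ∀ V : ℝ → EuclideanSpace ℝ (Fin 3) → Fin 3 → ℂ,
          Literature.Analysis.FluidPDE.FourierNS.IsFourierMild (4 * Real.pi ^ 2 * ν) 4 0 T V →
          V 0 = Literature.Analysis.FluidPDE.FourierNS.fourierData hu hd →
          ∀ t ∈ Set.Icc 0 T, ∀ ξ : EuclideanSpace ℝ (Fin 3), ‖ξ‖ ^ 2 * ‖V t ξ‖ ≤ C) →
      ∃ (u : ℝ → EuclideanSpace ℝ (Fin 3) → EuclideanSpace ℝ (Fin 3))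
        (p : ℝ → EuclideanSpace ℝ (Fin 3) → ℝ),
        Literature.Analysis.FluidPDE.IsSmoothOnHalfSpace u ∧
        Literature.Analysis.FluidPDE.IsSmoothOnHalfSpace p ∧
        Literature.Analysis.FluidPDE.IsNavierStokesSolution ν 0 u₀ u p ∧
        Literature.Analysis.FluidPDE.HasBoundedEnergy u :=
  Theorems.BoundedEnvelope.stub_ofLiouvillePM2
    (Theorems.BoundedEnvelope.liouvillePM2_of_liouvilleMorrey
      (Theorems.BoundedEnvelope.stub_liouvilleMorreyOfNoLocalTypeI hno))

end Summit.NavierStokesRegularity.NavierStokesRegularity.Cruxes.BoundedEnvelopeContinuation.Birth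

end
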